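import Summits.BirchSwinnertonDyer.BirchSwinnertonDyer.Theorems.TwoAdicConverseRankZeroKolyvaginBigImage
import Literature.NumberTheory.EllipticCurves.TwoAdicImageGoodOrdinaryAtTwoProofs
import Literature.NumberTheory.EllipticCurves.Greenberg1999.TwoTorsionMuInvariant
import HarnessLib

/-!
# Route TwoAdicConverse — the OFF-big-image-habitat complement of the rank-`0` `2`-converse,
# stratified by the level at which `ρ̄_{E,2^m}` first fails to be onto (kernel glue; proofs only)

Cell `bsd-2adic`, seat `bsd-2adic-conv-1` GEN 18, HELD split parent item stmt-BirchSwinnertonDyer-19218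
`GoodOrdinaryRankZeroTwoConverse` (`--supports`; nothing here closes it).  Planner RC-209 / KRR2 memo v3
ADDENDUM B: on the surjective-`2`-adic-image habitat the `r = 0` cruxes 19218/19219 follow from the
Kolyvagin-at-`2` cruxes 24622 V1′ + 24623 V2♭ (GEN 17, p607060
`TwoAdicKolyvaginRankZero.goodOrdinaryRankZeroTwoConverse_of_kolyvaginAtTwo_of_offBigImage`), modulo ONE
off-habitat binder `hOff : ∀ W, ¬CM → GoodOrd W 2 → ¬(∀ m, ρ̄_{W,2^m} onto) → corank₂ = 0 → r_an = 0`
(to be filed as `R0OffBigImageGoodOrd` when KRR2's residual 24303 is split).  This file TYPES that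
complement: by Dokchitser–Dokchitser 2012 (PROVED in the tree: `hasSurjectiveModNGaloisRep_{two,four,
eight}_iff`, `…two_pow_of_eight_holds`; assembled in
`Literature/…/TwoAdicImageNonSurjectiveFamiliesProofs`, p613962) a curve is off the habitat iff it
lies in one of four LEVEL STRATA — (S2t) a rational point of order `2` (`E[2]` reducible: the planner's
case (β)); (S2c) `E(ℚ)[2] = 0` but `ρ̄₂` not onto (`C₃` image: `Δ ∈ ℚ^{×2}`); (S4) `ρ̄₂` onto, `ρ̄₄` not
onto (`-Δ ∈ ℚ^{×2}`, or `j = -4t³(t + 8)` — the Dokchitser–Dokchitser curve, image conjugate into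
`ℍ ≤ GL₂(ℤ/4ℤ)` of index `4`); (S8) `ρ̄₄` onto, `ρ̄₈` not onto (`2Δ` or `-2Δ ∈ ℚ^{×2}`) — equivalently
in five DIOPHANTINE FAMILIES (β) `E(ℚ)[2] ≠ 0`, (γ₁) `Δ ∈ ℚ^{×2}`, (γ₂) `-Δ ∈ ℚ^{×2}`, (γ₃)
`j = -4t³(t + 8)`, (γ₄) `±2Δ ∈ ℚ^{×2}`; and proves the GLUE: the conjunction of the stratum-pieces
(each a restricted ∀-statement of 19218's shape) gives `hOff`, hence — with V1′ + V2♭ + PRINT through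
p607060 — the route decl `GoodOrdinaryRankZeroTwoConverse` BY NAME
(`goodOrdinaryRankZeroTwoConverse_of_kolyvaginAtTwo_of_strata`, `…_of_families`).  The companion file
`TwoAdicConverseOffHabitatStrataLeaf` does the same for the rung leaf `NonCMTwoConverse` (`r ≤ 1`) and
drops the `¬ W.HasCM` binder from the habitat theorems (it is implied by the habitat binder:
`WeierstrassCurve.not_hasCM_of_forall_hasSurjectiveModNGaloisRep_two_pow`, p613962).

**At a good ORDINARY `2` only THREE strata survive** (§4; `Literature/…/TwoAdicImageGoodOrdinaryAtTwoProofs`):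
the minimal discriminant is odd and `j` is a `2`-adic unit, so (S8)/(γ₄) (`±2Δ ∈ ℚ^{×2}`) and the
Dokchitser–Dokchitser curve (γ₃) (`j = -4t³(t + 8)`, `2`-adic valuation `≡ 2 (mod 4)` or `≥ 14`) are
EMPTY: item 19218's off-habitat complement is (β) rational `2`-torsion ∪ (γ₁) `C₃` image
(`Δ ∈ ℚ^{×2}`) ∪ (γ₂) `ρ̄₂` onto with `-Δ ∈ ℚ^{×2}` — `goodOrdinaryRankZeroTwoConverse_of_kolyvaginAtTwo_of_three_strata`.

Also recorded (§1): the (β) piece in the cell's abscissa currency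
(`exists_two_torsion_iff_exists_hasRationalTwoTorsionX` ↔ `Greenberg1999.HasRationalTwoTorsionX`, the
spelling of the class kits `ByReductionTypeAtTwoOrdRedClassKit`).

HONEST FRAMING.  Pure logic over PROVED image theorems: V1′, V2♭ (Kolyvagin at `2`, printed for
`p ≥ 5` only) and the stratum pieces are OPEN and carried as hypotheses; the PRINT inputs (BFH, HL,
`2`-parity, GZK, Kato finiteness, GZ over `K`, reciprocity, modularity) are the tree's named facts, taken
as hypotheses and never discharged here.  No item is filed by this file (D-0014); no stratum piece is
claimed; nothing is booked (D-0054); BSD is not proved by any of this.  PARTITION: none — RANK axis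
(S3); companion cell X5@2 good-ord/mult, off-habitat complement.

References: T. Dokchitser, V. Dokchitser, Math. Z. 272 (2012) 961–964 [DokchitserDokchitserMathZ2012];
J. Rouse, D. Zureick-Brown, Res. Number Theory 1 (2015) [RouseZureickbrown2015]; Á. Lozano-Robledo,
Algebra Number Theory 16 (2022) Thm 1.1 [LozanoRobledo2022]; W. Zhang, Camb. J. Math. 2 (2014) Thm 1.1
[WZhang2014]; R. Greenberg, LNM 1716 (1999) Prop. 5.14 [GreenbergLNM1716].
-/

set_option autoImplicit false
-- the Theorems namespace of this sub repeats the summit name by design (D-0017 nested layout)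
set_option linter.dupNamespace false

namespace Summit.BirchSwinnertonDyer.BirchSwinnertonDyer.Theorems.TwoAdicOffHabitat

open Literature Literature.NumberTheory.EllipticCurves Literature.NumberTheory.EllipticCurves.ModularForms
  Literature.NumberTheory.EllipticCurves.Rank1Residual
  Literature.NumberTheory.EllipticCurves.Greenberg1999
  Summit.BirchSwinnertonDyer.BirchSwinnertonDyer.Theses.TwoAdicConverse
  Summit.BirchSwinnertonDyer.BirchSwinnertonDyer.Theorems.TwoAdicKolyvaginRankZero

/-! ## §1 Stratum (β) in the cell's abscissa currency -/

/-- **A rational point of exact order `2` ⟺ an abscissa `x` with `HasRationalTwoTorsionX W x`**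
(Greenberg's "`E(ℚ)` contains an element of order `2` with `x(P) = x`", LNM 1716 Prop. 5.14): a
non-zero affine point `P = (x, y)` has `2P = 0` iff `P = -P` iff `y = -y - a₁x - a₃`.
[cite: GreenbergLNM1716, Prop. 5.14] [cite: SilvermanAEC2009, Prop. III.2.3 (points of order 2)] -/
theorem exists_two_torsion_iff_exists_hasRationalTwoTorsionX (W : WeierstrassCurve ℚ) [W.IsElliptic] :
    (∃ P : W.toAffine.Point, P ≠ 0 ∧ 2 • P = 0) ↔ ∃ x : ℚ, HasRationalTwoTorsionX W x := by
  constructor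
  · rintro ⟨P, hP0, h2P⟩
    rcases P with _ | ⟨x, y, hns⟩
    · exact absurd rfl hP0
    · refine ⟨x, y, hns.left, ?_⟩
      by_contra hy'
      have hy : y ≠ W.toAffine.negY x y := by
        intro h
        apply hy'
        rw [WeierstrassCurve.Affine.negY] at h
        linear_combination h
      rw [two_nsmul, WeierstrassCurve.Affine.Point.add_self_of_Y_ne hy] at h2P
      exact WeierstrassCurve.Affine.Point.some_ne_zero _ h2P
  · rintro ⟨x, y, hEq, h2⟩
    refine ⟨.some _ _ ((WeierstrassCurve.Affine.equation_iff_nonsingular).mp hEq),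
      WeierstrassCurve.Affine.Point.some_ne_zero _, ?_⟩
    rw [two_nsmul, WeierstrassCurve.Affine.Point.add_self_of_Y_eq]
    rw [WeierstrassCurve.Affine.negY]
    linear_combination h2

/-- **No rational point of order `2` ⟺ no abscissa with `HasRationalTwoTorsionX`** (the hypothesis
spelling of Dokchitser–Dokchitser (1) versus the class kits' `∀ x, ¬ HasRationalTwoTorsionX W x`).
[cite: GreenbergLNM1716, Prop. 5.14] [cite: DokchitserDokchitserMathZ2012, Theorem (1)] -/
theorem forall_two_nsmul_iff_forall_not_hasRationalTwoTorsionX (W : WeierstrassCurve ℚ) [W.IsElliptic] :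
    (∀ P : W.toAffine.Point, 2 • P = 0 → P = 0) ↔ ∀ x : ℚ, ¬ HasRationalTwoTorsionX W x := by
  constructor
  · intro h x hx
    obtain ⟨P, hP0, h2P⟩ :=
      (exists_two_torsion_iff_exists_hasRationalTwoTorsionX W).mpr ⟨x, hx⟩
    exact hP0 (h P h2P)
  · intro h P h2P
    by_contra hP0
    obtain ⟨x, hx⟩ := (exists_two_torsion_iff_exists_hasRationalTwoTorsionX W).mp ⟨P, hP0, h2P⟩
    exact h x hx

/-! ## §2 Eliminators: off the habitat means one of the strata -/

/-- **Off-habitat eliminator, by LEVEL**: if `ρ_{W,2^∞}` is not onto then `ρ̄₂` is not onto, or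
`ρ̄₂` is onto and `ρ̄₄` is not, or `ρ̄₄` is onto and `ρ̄₈` is not (the `2`-adic image is decided
modulo `8`). [cite: DokchitserDokchitserMathZ2012, Introduction (p. 961)] [cite: RouseZureickbrown2015, §3 Lemma and §1] -/
theorem offHabitat_elim_level {W : WeierstrassCurve ℚ} [W.IsElliptic] {C : Prop}
    (hoff : ¬ ∀ m : ℕ, W.HasSurjectiveModNGaloisRep (2 ^ m : ℕ))
    (h2 : ¬ W.HasSurjectiveModNGaloisRep 2 → C)
    (h4 : W.HasSurjectiveModNGaloisRep 2 → ¬ W.HasSurjectiveModNGaloisRep 4 → C)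
    (h8 : W.HasSurjectiveModNGaloisRep 4 → ¬ W.HasSurjectiveModNGaloisRep 8 → C) : C := by
  by_cases hs2 : W.HasSurjectiveModNGaloisRep 2
  · by_cases hs4 : W.HasSurjectiveModNGaloisRep 4
    · refine h8 hs4 fun hs8 ↦ hoff ?_
      exact (forall_hasSurjectiveModNGaloisRep_two_pow_iff_eight W).mpr hs8
    · exact h4 hs2 hs4
  · exact h2 hs2

/-- **Off-habitat eliminator, by STRATUM**: if `ρ_{W,2^∞}` is not onto then (S2t) `W(ℚ)` has a point of
order `2`, or (S2c) it has none and `ρ̄₂` is still not onto (`C₃` image), or (S4) `ρ̄₂` onto and `ρ̄₄`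
not, or (S8) `ρ̄₄` onto and `ρ̄₈` not. [cite: DokchitserDokchitserMathZ2012, Theorem (1)–(3)] -/
theorem offHabitat_elim_strata {W : WeierstrassCurve ℚ} [W.IsElliptic] {C : Prop}
    (hoff : ¬ ∀ m : ℕ, W.HasSurjectiveModNGaloisRep (2 ^ m : ℕ))
    (h2t : (∃ P : W.toAffine.Point, P ≠ 0 ∧ 2 • P = 0) → C)
    (h2c : (∀ P : W.toAffine.Point, 2 • P = 0 → P = 0) → ¬ W.HasSurjectiveModNGaloisRep 2 → C)
    (h4 : W.HasSurjectiveModNGaloisRep 2 → ¬ W.HasSurjectiveModNGaloisRep 4 → C)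
    (h8 : W.HasSurjectiveModNGaloisRep 4 → ¬ W.HasSurjectiveModNGaloisRep 8 → C) : C := by
  refine offHabitat_elim_level hoff (fun hs2 ↦ ?_) h4 h8
  by_cases ht : ∃ P : W.toAffine.Point, P ≠ 0 ∧ 2 • P = 0
  · exact h2t ht
  · refine h2c (fun P h2P ↦ ?_) hs2
    by_contra hP0
    exact ht ⟨P, hP0, h2P⟩

/-- **Off-habitat eliminator, by DIOPHANTINE FAMILY**: if `ρ_{W,2^∞}` is not onto then (β) `W(ℚ)` has a
point of order `2`, or (γ₁) it has none and `Δ ∈ ℚ^{×2}`, or (γ₂) `ρ̄₂` is onto and `-Δ ∈ ℚ^{×2}`, or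
(γ₃) `ρ̄₂` is onto, `-Δ ∉ ℚ^{×2}` and `j = -4t³(t + 8)` for some `t`, or (γ₄) `ρ̄₄` is onto and `2Δ`
or `-2Δ ∈ ℚ^{×2}`. [cite: DokchitserDokchitserMathZ2012, Theorem (1)–(3) and Lemma] -/
theorem offHabitat_elim_families {W : WeierstrassCurve ℚ} [W.IsElliptic] {C : Prop}
    (hoff : ¬ ∀ m : ℕ, W.HasSurjectiveModNGaloisRep (2 ^ m : ℕ))
    (hβ : (∃ P : W.toAffine.Point, P ≠ 0 ∧ 2 • P = 0) → C)
    (hγ₁ : (∀ P : W.toAffine.Point, 2 • P = 0 → P = 0) → IsSquare W.Δ → C)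
    (hγ₂ : W.HasSurjectiveModNGaloisRep 2 → IsSquare (-W.Δ) → C)
    (hγ₃ : W.HasSurjectiveModNGaloisRep 2 → ¬ IsSquare (-W.Δ) →
      (∃ t : ℚ, W.j = -4 * t ^ 3 * (t + 8)) → C)
    (hγ₄ : W.HasSurjectiveModNGaloisRep 4 → IsSquare (2 * W.Δ) ∨ IsSquare (-2 * W.Δ) → C) : C := by
  refine offHabitat_elim_strata hoff hβ (fun hno hs2 ↦ ?_) (fun hs2 hs4 ↦ ?_) (fun hs4 hs8 ↦ ?_)
  · -- no `2`-torsion and `ρ̄₂` not onto: `Δ` is a square (Dokchitser–Dokchitser (1))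
    refine hγ₁ hno ?_
    by_contra hΔ
    exact hs2 ((hasSurjectiveModNGaloisRep_two_iff W).mpr ⟨hno, hΔ⟩)
  · -- `ρ̄₂` onto, `ρ̄₄` not: `-Δ` square or `j` on the Dokchitser–Dokchitser curve (2)
    by_cases hΔ : IsSquare (-W.Δ)
    · exact hγ₂ hs2 hΔ
    · refine hγ₃ hs2 hΔ ?_
      by_contra hj
      refine hs4 ((DokchitserDokchitser2012.hasSurjectiveModNGaloisRep_four_iff W).mpr
        ⟨hs2, hΔ, fun t ht ↦ hj ⟨t, ht⟩⟩)
  · -- `ρ̄₄` onto, `ρ̄₈` not: `±2Δ` square (3)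
    refine hγ₄ hs4 ?_
    by_contra h
    rcases not_or.mp h with ⟨h₁, h₂⟩
    exact hs8 ((DokchitserDokchitser2012.hasSurjectiveModNGaloisRep_eight_iff W).mpr ⟨hs4, h₁, h₂⟩)

/-! ## §3 The off-habitat binder of 19218 from its stratum pieces, and the route decl BY NAME -/

/-- **`hOff` (good ordinary, `r = 0`) from its four LEVEL-stratum pieces.**  Each piece is 19218's
statement restricted to one stratum: (S2t) rational `2`-torsion [the planner's case (β): GV /
Kida–Matsuno, Eisenstein ideal at `2`]; (S2c) `C₃` image modulo `2`; (S4) onto modulo `2`, not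
modulo `4`; (S8) onto modulo `4`, not modulo `8`.  Conclusion: verbatim the `hOff` binder of p607060
§4. [cite: DokchitserDokchitserMathZ2012, Theorem (1)–(3)] [cite: RouseZureickbrown2015, §1] -/
theorem goodOrd_offBigImage_rankZero_of_strata
    (h2t : ∀ (W : WeierstrassCurve ℚ) [W.IsElliptic] [W.IsGloballyMinimal], ¬ W.HasCM → GoodOrd W 2 →
      (∃ P : W.toAffine.Point, P ≠ 0 ∧ 2 • P = 0) → W.selmerCorank 2 = 0 → W.analyticRank = 0)
    (h2c : ∀ (W : WeierstrassCurve ℚ) [W.IsElliptic] [W.IsGloballyMinimal], ¬ W.HasCM → GoodOrd W 2 →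
      (∀ P : W.toAffine.Point, 2 • P = 0 → P = 0) → ¬ W.HasSurjectiveModNGaloisRep 2 →
      W.selmerCorank 2 = 0 → W.analyticRank = 0)
    (h4 : ∀ (W : WeierstrassCurve ℚ) [W.IsElliptic] [W.IsGloballyMinimal], ¬ W.HasCM → GoodOrd W 2 →
      W.HasSurjectiveModNGaloisRep 2 → ¬ W.HasSurjectiveModNGaloisRep 4 →
      W.selmerCorank 2 = 0 → W.analyticRank = 0)
    (h8 : ∀ (W : WeierstrassCurve ℚ) [W.IsElliptic] [W.IsGloballyMinimal], ¬ W.HasCM → GoodOrd W 2 →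
      W.HasSurjectiveModNGaloisRep 4 → ¬ W.HasSurjectiveModNGaloisRep 8 →
      W.selmerCorank 2 = 0 → W.analyticRank = 0) :
    ∀ (W : WeierstrassCurve ℚ) [W.IsElliptic] [W.IsGloballyMinimal], ¬ W.HasCM → GoodOrd W 2 →
      ¬ (∀ m : ℕ, W.HasSurjectiveModNGaloisRep (2 ^ m : ℕ)) →
      W.selmerCorank 2 = 0 → W.analyticRank = 0 := by
  intro W _ _ hCM hgo hoff hc
  exact offHabitat_elim_strata hoff (fun h ↦ h2t W hCM hgo h hc) (fun h h' ↦ h2c W hCM hgo h h' hc)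
    (fun h h' ↦ h4 W hCM hgo h h' hc) (fun h h' ↦ h8 W hCM hgo h h' hc)

/-- **`hOff` (good ordinary, `r = 0`) from its five DIOPHANTINE-family pieces** (β) `E(ℚ)[2] ≠ 0`,
(γ₁) `E(ℚ)[2] = 0 ∧ Δ ∈ ℚ^{×2}`, (γ₂) `ρ̄₂` onto ∧ `-Δ ∈ ℚ^{×2}`, (γ₃) `ρ̄₂` onto ∧ `-Δ ∉ ℚ^{×2}` ∧
`j = -4t³(t + 8)`, (γ₄) `ρ̄₄` onto ∧ `±2Δ ∈ ℚ^{×2}`.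
[cite: DokchitserDokchitserMathZ2012, Theorem (1)–(3) and Lemma] -/
theorem goodOrd_offBigImage_rankZero_of_families
    (hβ : ∀ (W : WeierstrassCurve ℚ) [W.IsElliptic] [W.IsGloballyMinimal], ¬ W.HasCM → GoodOrd W 2 →
      (∃ P : W.toAffine.Point, P ≠ 0 ∧ 2 • P = 0) → W.selmerCorank 2 = 0 → W.analyticRank = 0)
    (hγ₁ : ∀ (W : WeierstrassCurve ℚ) [W.IsElliptic] [W.IsGloballyMinimal], ¬ W.HasCM → GoodOrd W 2 →
      (∀ P : W.toAffine.Point, 2 • P = 0 → P = 0) → IsSquare W.Δ →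
      W.selmerCorank 2 = 0 → W.analyticRank = 0)
    (hγ₂ : ∀ (W : WeierstrassCurve ℚ) [W.IsElliptic] [W.IsGloballyMinimal], ¬ W.HasCM → GoodOrd W 2 →
      W.HasSurjectiveModNGaloisRep 2 → IsSquare (-W.Δ) →
      W.selmerCorank 2 = 0 → W.analyticRank = 0)
    (hγ₃ : ∀ (W : WeierstrassCurve ℚ) [W.IsElliptic] [W.IsGloballyMinimal], ¬ W.HasCM → GoodOrd W 2 →
      W.HasSurjectiveModNGaloisRep 2 → ¬ IsSquare (-W.Δ) → (∃ t : ℚ, W.j = -4 * t ^ 3 * (t + 8)) →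
      W.selmerCorank 2 = 0 → W.analyticRank = 0)
    (hγ₄ : ∀ (W : WeierstrassCurve ℚ) [W.IsElliptic] [W.IsGloballyMinimal], ¬ W.HasCM → GoodOrd W 2 →
      W.HasSurjectiveModNGaloisRep 4 → (IsSquare (2 * W.Δ) ∨ IsSquare (-2 * W.Δ)) →
      W.selmerCorank 2 = 0 → W.analyticRank = 0) :
    ∀ (W : WeierstrassCurve ℚ) [W.IsElliptic] [W.IsGloballyMinimal], ¬ W.HasCM → GoodOrd W 2 →
      ¬ (∀ m : ℕ, W.HasSurjectiveModNGaloisRep (2 ^ m : ℕ)) →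
      W.selmerCorank 2 = 0 → W.analyticRank = 0 := by
  intro W _ _ hCM hgo hoff hc
  exact offHabitat_elim_families hoff (fun h ↦ hβ W hCM hgo h hc) (fun h h' ↦ hγ₁ W hCM hgo h h' hc)
    (fun h h' ↦ hγ₂ W hCM hgo h h' hc) (fun h h' h'' ↦ hγ₃ W hCM hgo h h' h'' hc)
    (fun h h' ↦ hγ₄ W hCM hgo h h' hc)

/-- **Item 19218 `GoodOrdinaryRankZeroTwoConverse` BY NAME from Kolyvagin at `2` on the habitat
(V1′ 24622 + V2♭ 24623 + 24405 + PRINT, p607060) and the four LEVEL-stratum pieces of its off-habitat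
complement.**  The route decl, fully qualified. [cite: WZhang2014, Thm. 1.1 (shape at p ≥ 5)]
[cite: DokchitserDokchitserMathZ2012, Theorem (1)–(3)] -/
theorem goodOrdinaryRankZeroTwoConverse_of_kolyvaginAtTwo_of_strata
    (hV1 : KolyvaginNonvanishingAtTwoFrame) (hV2 : KolyvaginCorankLowerBoundAtTwo)
    (hT : NoTwoTorsionOverK)
    (hmod : exists_isNewformOf)
    (hBFH : bumpFriedbergHoffstein_exists_heegnerField_split_twist_simpleZero)
    (hpar : ∀ (V : WeierstrassCurve ℚ) [V.IsElliptic], p_parity V 2)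
    (hGZK : rank_eq_analyticRank_of_analyticRank_le_one)
    (hE : WeierstrassCurve.hasEntireLFunction_rat)
    (hGZ : ∀ (V : WeierstrassCurve ℚ) (N : ℕ) [NeZero N] (K : Type) [Field K] [NumberField K],
      analyticRankEK_eq_one_iff_heegner_nonTorsion V N K)
    (hrec : ∀ (N : ℕ) [NeZero N] (V : WeierstrassCurve ℚ) (K : Type) [Field K] [NumberField K],
      heegnerPointOfConductor_one_galoisConj N V K)
    (h2t : ∀ (W : WeierstrassCurve ℚ) [W.IsElliptic] [W.IsGloballyMinimal], ¬ W.HasCM → GoodOrd W 2 →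
      (∃ P : W.toAffine.Point, P ≠ 0 ∧ 2 • P = 0) → W.selmerCorank 2 = 0 → W.analyticRank = 0)
    (h2c : ∀ (W : WeierstrassCurve ℚ) [W.IsElliptic] [W.IsGloballyMinimal], ¬ W.HasCM → GoodOrd W 2 →
      (∀ P : W.toAffine.Point, 2 • P = 0 → P = 0) → ¬ W.HasSurjectiveModNGaloisRep 2 →
      W.selmerCorank 2 = 0 → W.analyticRank = 0)
    (h4 : ∀ (W : WeierstrassCurve ℚ) [W.IsElliptic] [W.IsGloballyMinimal], ¬ W.HasCM → GoodOrd W 2 →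
      W.HasSurjectiveModNGaloisRep 2 → ¬ W.HasSurjectiveModNGaloisRep 4 →
      W.selmerCorank 2 = 0 → W.analyticRank = 0)
    (h8 : ∀ (W : WeierstrassCurve ℚ) [W.IsElliptic] [W.IsGloballyMinimal], ¬ W.HasCM → GoodOrd W 2 →
      W.HasSurjectiveModNGaloisRep 4 → ¬ W.HasSurjectiveModNGaloisRep 8 →
      W.selmerCorank 2 = 0 → W.analyticRank = 0) :
    Summit.BirchSwinnertonDyer.BirchSwinnertonDyer.Theses.TwoAdicConverse.GoodOrdinaryRankZeroTwoConverse :=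
  goodOrdinaryRankZeroTwoConverse_of_kolyvaginAtTwo_of_offBigImage hV1 hV2 hT hmod hBFH hpar hGZK hE hGZ
    hrec (goodOrd_offBigImage_rankZero_of_strata h2t h2c h4 h8)

/-- **Item 19218 `GoodOrdinaryRankZeroTwoConverse` BY NAME from Kolyvagin at `2` on the habitat and
the five DIOPHANTINE-family pieces (β), (γ₁)–(γ₄) of its off-habitat complement.**
[cite: WZhang2014, Thm. 1.1 (shape at p ≥ 5)] [cite: DokchitserDokchitserMathZ2012, Theorem (1)–(3) and Lemma] -/
theorem goodOrdinaryRankZeroTwoConverse_of_kolyvaginAtTwo_of_families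
    (hV1 : KolyvaginNonvanishingAtTwoFrame) (hV2 : KolyvaginCorankLowerBoundAtTwo)
    (hT : NoTwoTorsionOverK)
    (hmod : exists_isNewformOf)
    (hBFH : bumpFriedbergHoffstein_exists_heegnerField_split_twist_simpleZero)
    (hpar : ∀ (V : WeierstrassCurve ℚ) [V.IsElliptic], p_parity V 2)
    (hGZK : rank_eq_analyticRank_of_analyticRank_le_one)
    (hE : WeierstrassCurve.hasEntireLFunction_rat)
    (hGZ : ∀ (V : WeierstrassCurve ℚ) (N : ℕ) [NeZero N] (K : Type) [Field K] [NumberField K],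
      analyticRankEK_eq_one_iff_heegner_nonTorsion V N K)
    (hrec : ∀ (N : ℕ) [NeZero N] (V : WeierstrassCurve ℚ) (K : Type) [Field K] [NumberField K],
      heegnerPointOfConductor_one_galoisConj N V K)
    (hβ : ∀ (W : WeierstrassCurve ℚ) [W.IsElliptic] [W.IsGloballyMinimal], ¬ W.HasCM → GoodOrd W 2 →
      (∃ P : W.toAffine.Point, P ≠ 0 ∧ 2 • P = 0) → W.selmerCorank 2 = 0 → W.analyticRank = 0)
    (hγ₁ : ∀ (W : WeierstrassCurve ℚ) [W.IsElliptic] [W.IsGloballyMinimal], ¬ W.HasCM → GoodOrd W 2 →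
      (∀ P : W.toAffine.Point, 2 • P = 0 → P = 0) → IsSquare W.Δ →
      W.selmerCorank 2 = 0 → W.analyticRank = 0)
    (hγ₂ : ∀ (W : WeierstrassCurve ℚ) [W.IsElliptic] [W.IsGloballyMinimal], ¬ W.HasCM → GoodOrd W 2 →
      W.HasSurjectiveModNGaloisRep 2 → IsSquare (-W.Δ) →
      W.selmerCorank 2 = 0 → W.analyticRank = 0)
    (hγ₃ : ∀ (W : WeierstrassCurve ℚ) [W.IsElliptic] [W.IsGloballyMinimal], ¬ W.HasCM → GoodOrd W 2 →
      W.HasSurjectiveModNGaloisRep 2 → ¬ IsSquare (-W.Δ) → (∃ t : ℚ, W.j = -4 * t ^ 3 * (t + 8)) →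
      W.selmerCorank 2 = 0 → W.analyticRank = 0)
    (hγ₄ : ∀ (W : WeierstrassCurve ℚ) [W.IsElliptic] [W.IsGloballyMinimal], ¬ W.HasCM → GoodOrd W 2 →
      W.HasSurjectiveModNGaloisRep 4 → (IsSquare (2 * W.Δ) ∨ IsSquare (-2 * W.Δ)) →
      W.selmerCorank 2 = 0 → W.analyticRank = 0) :
    Summit.BirchSwinnertonDyer.BirchSwinnertonDyer.Theses.TwoAdicConverse.GoodOrdinaryRankZeroTwoConverse :=
  goodOrdinaryRankZeroTwoConverse_of_kolyvaginAtTwo_of_offBigImage hV1 hV2 hT hmod hBFH hpar hGZK hE hGZ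
    hrec (goodOrd_offBigImage_rankZero_of_families hβ hγ₁ hγ₂ hγ₃ hγ₄)

/-! ## §4 At a good ORDINARY `2`: three strata suffice for item 19218 -/

/-- **`hOff` (good ordinary, `r = 0`) from THREE pieces**: at a good ordinary `2` the families (γ₃)
`j = -4t³(t + 8)` and (γ₄) `±2Δ ∈ ℚ^{×2}` are empty (`offHabitat_elim_of_goodOrd_two`: `Δ_min` odd,
`j` a `2`-adic unit), so the off-habitat binder of p607060 §4 follows from (β) rational `2`-torsion,
(γ₁) no `2`-torsion and `Δ ∈ ℚ^{×2}` (`C₃` image), (γ₂) `ρ̄₂` onto and `-Δ ∈ ℚ^{×2}`.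
[cite: DokchitserDokchitserMathZ2012, Theorem (1)–(3) and Lemma] [cite: SilvermanAEC2009, VII.5 Prop. 5.1(a), V.4] -/
theorem goodOrd_offBigImage_rankZero_of_three_strata
    (hβ : ∀ (W : WeierstrassCurve ℚ) [W.IsElliptic] [W.IsGloballyMinimal], ¬ W.HasCM → GoodOrd W 2 →
      (∃ P : W.toAffine.Point, P ≠ 0 ∧ 2 • P = 0) → W.selmerCorank 2 = 0 → W.analyticRank = 0)
    (hγ₁ : ∀ (W : WeierstrassCurve ℚ) [W.IsElliptic] [W.IsGloballyMinimal], ¬ W.HasCM → GoodOrd W 2 →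
      (∀ P : W.toAffine.Point, 2 • P = 0 → P = 0) → IsSquare W.Δ →
      W.selmerCorank 2 = 0 → W.analyticRank = 0)
    (hγ₂ : ∀ (W : WeierstrassCurve ℚ) [W.IsElliptic] [W.IsGloballyMinimal], ¬ W.HasCM → GoodOrd W 2 →
      W.HasSurjectiveModNGaloisRep 2 → IsSquare (-W.Δ) →
      W.selmerCorank 2 = 0 → W.analyticRank = 0) :
    ∀ (W : WeierstrassCurve ℚ) [W.IsElliptic] [W.IsGloballyMinimal], ¬ W.HasCM → GoodOrd W 2 →
      ¬ (∀ m : ℕ, W.HasSurjectiveModNGaloisRep (2 ^ m : ℕ)) →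
      W.selmerCorank 2 = 0 → W.analyticRank = 0 := by
  intro W _ _ hCM hgo hoff hc
  exact offHabitat_elim_of_goodOrd_two W hgo hoff (fun h ↦ hβ W hCM hgo h hc)
    (fun h h' ↦ hγ₁ W hCM hgo h h' hc) (fun h h' ↦ hγ₂ W hCM hgo h h' hc)

/-- **Item 19218 `GoodOrdinaryRankZeroTwoConverse` BY NAME from Kolyvagin at `2` on the habitat
(V1′ 24622 + V2♭ 24623 + 24405 + PRINT, p607060) and THREE off-habitat pieces** (β) rational
`2`-torsion [`E[2]` reducible: the Eisenstein/GV case], (γ₁) `C₃` image modulo `2`, (γ₂) `ρ̄₂` onto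
with `-Δ ∈ ℚ^{×2}` — the other two families of the general classification being empty at a good
ordinary `2`.  The route decl, fully qualified. [cite: WZhang2014, Thm. 1.1 (shape at p ≥ 5)]
[cite: DokchitserDokchitserMathZ2012, Theorem (1)–(3) and Lemma] -/
theorem goodOrdinaryRankZeroTwoConverse_of_kolyvaginAtTwo_of_three_strata
    (hV1 : KolyvaginNonvanishingAtTwoFrame) (hV2 : KolyvaginCorankLowerBoundAtTwo)
    (hT : NoTwoTorsionOverK)
    (hmod : exists_isNewformOf)
    (hBFH : bumpFriedbergHoffstein_exists_heegnerField_split_twist_simpleZero)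
    (hpar : ∀ (V : WeierstrassCurve ℚ) [V.IsElliptic], p_parity V 2)
    (hGZK : rank_eq_analyticRank_of_analyticRank_le_one)
    (hE : WeierstrassCurve.hasEntireLFunction_rat)
    (hGZ : ∀ (V : WeierstrassCurve ℚ) (N : ℕ) [NeZero N] (K : Type) [Field K] [NumberField K],
      analyticRankEK_eq_one_iff_heegner_nonTorsion V N K)
    (hrec : ∀ (N : ℕ) [NeZero N] (V : WeierstrassCurve ℚ) (K : Type) [Field K] [NumberField K],
      heegnerPointOfConductor_one_galoisConj N V K)
    (hβ : ∀ (W : WeierstrassCurve ℚ) [W.IsElliptic] [W.IsGloballyMinimal], ¬ W.HasCM → GoodOrd W 2 →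
      (∃ P : W.toAffine.Point, P ≠ 0 ∧ 2 • P = 0) → W.selmerCorank 2 = 0 → W.analyticRank = 0)
    (hγ₁ : ∀ (W : WeierstrassCurve ℚ) [W.IsElliptic] [W.IsGloballyMinimal], ¬ W.HasCM → GoodOrd W 2 →
      (∀ P : W.toAffine.Point, 2 • P = 0 → P = 0) → IsSquare W.Δ →
      W.selmerCorank 2 = 0 → W.analyticRank = 0)
    (hγ₂ : ∀ (W : WeierstrassCurve ℚ) [W.IsElliptic] [W.IsGloballyMinimal], ¬ W.HasCM → GoodOrd W 2 →
      W.HasSurjectiveModNGaloisRep 2 → IsSquare (-W.Δ) →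
      W.selmerCorank 2 = 0 → W.analyticRank = 0) :
    Summit.BirchSwinnertonDyer.BirchSwinnertonDyer.Theses.TwoAdicConverse.GoodOrdinaryRankZeroTwoConverse :=
  goodOrdinaryRankZeroTwoConverse_of_kolyvaginAtTwo_of_offBigImage hV1 hV2 hT hmod hBFH hpar hGZK hE hGZ
    hrec (goodOrd_offBigImage_rankZero_of_three_strata hβ hγ₁ hγ₂)

end Summit.BirchSwinnertonDyer.BirchSwinnertonDyer.Theorems.TwoAdicOffHabitat
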